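import Summits.NavierStokesRegularity.NavierStokesRegularity.Theorems.FilamentSkeletonRssKelvinGateMaxPrinciple
import Summits.NavierStokesRegularity.NavierStokesRegularity.Theorems.FilamentSkeletonRssKelvinGateDivergence
import Literature.Analysis.FluidPDE.PressurePoisson
import Literature.Analysis.FluidPDE.TsaiSelfSimilarBounded

/-!
# Route `FilamentSkeletonRss` · crux `TransverseReductionRJ` (stmt-NavierStokesRegularity-21221) — line `kelvin_gate`,
# stub S2′ `EventualKelvinGate`: the FREE linearised profile operator WITH PRESSURE has trivial kernel
# (divergence-free `C³` velocity decaying at infinity, bounded `C²` pressure)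

Helper file (theorems only, `--supports stmt-NavierStokesRegularity-21221 --as helper`).  HONEST FRAMING: bookkeeping for
a HYPOTHETICAL filament-type RSS blow-up route; nothing here bears on Navier–Stokes regularity; the stub is neither proved
nor refuted.

The uniqueness half of the "free gate" (base `U⁰ = 0`; hypothesis H1 of the rate-locking memo, evidence #26), now for the
Stokes-type system: if `W ∈ C³` is divergence free and tends to `0` at infinity, `Q ∈ C²` is bounded, and
`α(e₃ × W − DW[e₃ × y]) + ½W + ½DW[y] − ΔW + ∇Q = 0` pointwise, then `W = 0` and `∇Q = 0`
(`eq_zero_of_lerayLin_zero_base_add_gradient`).  Proof: the linear terms preserve incompressibility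
(`divergence_lerayLin_of_isDivFree` with `U⁰ = 0`: `div 𝓛W = 0`), so `ΔQ = div ∇Q = −div 𝓛W = 0`; a bounded harmonic
function is constant (`Literature.Analysis.FluidPDE.isConst_of_harmonic_bounded`, Gilbarg–Trudinger Thm 2.10), so `∇Q = 0`
and the velocity equation `𝓛W = 0` falls to the maximum principle `eq_zero_of_lerayLin_zero_base_eq_zero`.  The X-bounded
form `XBound.eq_zero_of_free_stokes` is the statement in the gate's own scale.

What this is NOT: existence/bounds for the free inverse (the Mehler/transport construction), anything around a non-zero
base, or any Fredholm statement.
-/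

set_option linter.dupNamespace false

noncomputable section

namespace Summit.NavierStokesRegularity.NavierStokesRegularity.Theorems.KelvinGate

open Set Function Filter Metric
open Literature.Analysis.FluidPDE
open scoped InnerProductSpace RealInnerProductSpace Laplacian ContDiff Topology BigOperators

/-- The constant zero field is divergence free. -/
theorem isDivFree_zero : VectorCalculus.IsDivFree (fun _ : EuclideanSpace ℝ (Fin 3) => (0 : EuclideanSpace ℝ (Fin 3))) := by
  intro x
  simp [VectorCalculus.divergence]

/-- **The free linearisation preserves incompressibility**: for a divergence-free `C³` field `W` and every rate `α`,
`div(α(e₃ × W − DW[e₃ × y]) + ½W + ½DW[y] − ΔW) = 0` (`divergence_lerayLin_of_isDivFree` at the base `U⁰ = 0`). -/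
theorem divergence_lerayLin_zero_base (α : ℝ) {W : EuclideanSpace ℝ (Fin 3) → EuclideanSpace ℝ (Fin 3)}
    (hW : ContDiff ℝ 3 W) (hdiv : VectorCalculus.IsDivFree W) (y : EuclideanSpace ℝ (Fin 3)) :
    VectorCalculus.divergence (lerayLin α (fun _ => 0) W) y = 0 := by
  rw [divergence_lerayLin_of_isDivFree α contDiff_const hW isDivFree_zero hdiv y]
  simp

/-- **Trivial kernel of the free linearised profile operator with pressure.**  Let `α` be any rate, `W ∈ C³` divergence
free with `W(x) → 0` as `|x| → ∞`, `Q ∈ C²` bounded, and `𝓛_(α,0) W + ∇Q = 0` pointwise.  Then `W = 0` and `∇Q = 0`. -/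
theorem eq_zero_of_lerayLin_zero_base_add_gradient (α : ℝ) {W : EuclideanSpace ℝ (Fin 3) → EuclideanSpace ℝ (Fin 3)}
    {Q : EuclideanSpace ℝ (Fin 3) → ℝ} (hW : ContDiff ℝ 3 W) (hdiv : VectorCalculus.IsDivFree W)
    (hdec : ∀ η : ℝ, 0 < η → ∃ R : ℝ, ∀ x, R ≤ ‖x‖ → ‖W x‖ ≤ η)
    (hQ : ContDiff ℝ 2 Q) (hQb : ∃ M : ℝ, ∀ y, |Q y| ≤ M)
    (heq : ∀ y, lerayLin α (fun _ => 0) W y + gradient Q y = 0) :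
    W = 0 ∧ ∀ y, gradient Q y = 0 := by
  -- `∇Q = −𝓛W`, hence `ΔQ = div ∇Q = −div 𝓛W = 0`
  have hgrad : gradient Q = fun y => -lerayLin α (fun _ => 0) W y :=
    funext fun y => eq_neg_of_add_eq_zero_right (heq y)
  have hΔ : ∀ y, (Δ Q) y = 0 := by
    intro y
    rw [← divergence_gradient hQ y, hgrad]
    have hneg : VectorCalculus.divergence (fun z => -lerayLin α (fun _ => 0) W z) y =
        -VectorCalculus.divergence (lerayLin α (fun _ => 0) W) y := by
      simp only [VectorCalculus.divergence]
      rw [fderiv_fun_neg, ContinuousLinearMap.toLinearMap_neg, map_neg]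
    rw [hneg, divergence_lerayLin_zero_base α hW hdiv y, neg_zero]
  -- `Q` is a bounded harmonic function, hence constant
  have hharm : InnerProductSpace.HarmonicOnNhd Q univ := fun x _ =>
    ⟨hQ.contDiffAt, Filter.Eventually.of_forall fun y => by simpa using hΔ y⟩
  have hconst : ∀ x y, Q x = Q y := isConst_of_harmonic_bounded hharm hQb
  have hQc : Q = fun _ => Q 0 := funext fun y => hconst y 0
  have hgrad0 : ∀ y, gradient Q y = 0 := by
    intro y; rw [hQc]; exact gradient_fun_const y (Q 0)
  -- the velocity equation alone, and the maximum principle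
  have hvel : ∀ y, lerayLin α (fun _ => 0) W y = 0 := fun y => by
    have := heq y; rwa [hgrad0 y, add_zero] at this
  exact ⟨eq_zero_of_lerayLin_zero_base_eq_zero α (hW.of_le (by norm_num)) hdec hvel, hgrad0⟩

/-- **X-bounded form (the gate's own scale).**  An X-bounded, divergence-free `C³` field `W` and a bounded `C²` pressure `Q`
with `𝓛_(α,0) W + ∇Q = 0` pointwise satisfy `W = 0` and `∇Q = 0`: the free Stokes-type linearised profile operator is
INJECTIVE on the class a Kelvin gate maps into — for every rate `α`, with no smallness condition. -/
theorem XBound.eq_zero_of_free_stokes {W : EuclideanSpace ℝ (Fin 3) → EuclideanSpace ℝ (Fin 3)} {R : ℝ}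
    (h : XBound W R) (hW3 : ContDiff ℝ 3 W) (hdiv : VectorCalculus.IsDivFree W) (α : ℝ)
    {Q : EuclideanSpace ℝ (Fin 3) → ℝ} (hQ : ContDiff ℝ 2 Q) {M : ℝ} (hQb : ∀ y, |Q y| ≤ M)
    (heq : ∀ y, lerayLin α (fun _ => 0) W y + gradient Q y = 0) :
    W = 0 ∧ ∀ y, gradient Q y = 0 :=
  eq_zero_of_lerayLin_zero_base_add_gradient α hW3 hdiv h.decay hQ ⟨M, hQb⟩ heq

end Summit.NavierStokesRegularity.NavierStokesRegularity.Theorems.KelvinGate
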